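import Literature.Topology.FourManifolds.TautFoliationsConePositionRel
import Mathlib.Topology.MetricSpace.Thickening
import HarnessLib

/-!
# Cone positions with a fine mesh

Sibling of `TautFoliationsConePosition.lean` / `TautFoliationsConePositionRel.lean`: the box
assignment `exists_boxes` works for every sufficiently fine mesh, so the mesh can be taken finer
than any prescribed bound (`exists_boxes_ge`, same proof with `n > max (5L / min δ₁ η) N`), and
the relative cone position keeping the map on the tame edges of a region exists with a mesh at
least `N` (`exists_conePosition_rel_ge`). Used for the coned fence collar, where the outer
collar must contain whole rows of squares.

* `exists_boxes_ge`, `IsTransverselyOriented.exists_conePosition_rel_ge` (**proved**).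

All statements are [folklore] refinements of [cite: CamachoLinsNeto1985, Ch. VI §3 Prop. 1].
-/

noncomputable section

open Set Filter Metric Topology Function

namespace Literature.Topology.FourManifolds

namespace Foliation

open SquareGrid SquareGrid.Grid

variable {c₀ : ℝ × ℝ} {L : ℝ}
variable {B : Type*} [NormedAddCommGroup B] [ProperSpace B]
variable {M : Type*} [TopologicalSpace M] [T2Space M] (F : Foliation B M)

/-- **Box assignment with a mesh at least `N`.** As `exists_boxes`. [cite: CamachoLinsNeto1985, Ch. VI §3 Prop. 1] -/
theorem exists_boxes_ge (hL : 0 < L) {f : ℝ × ℝ → M} (hf : ContinuousOn f (closedBall c₀ L)) (N : ℕ) :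
    ∃ (n : ℕ) (hn : 0 < n) (box : Fin n × Fin n → OpenPartialHomeomorph M (B × ℝ)) (ρ : ℝ),
      N ≤ n ∧ 0 < ρ ∧ (∀ q, box q ∈ F.atlas) ∧
      (∀ q q', (grid c₀ hL hn).Adj q q' →
        subbox (box q) (box q (f ((grid c₀ hL hn).centre q))) ρ ⊆ (box q').source) ∧
      (∀ q q', (grid c₀ hL hn).Adj q q' → ∀ x ∈ (grid c₀ hL hn).sq q',
        f x ∈ subbox (box q) (box q (f ((grid c₀ hL hn).centre q))) (ρ / 4)) := by
  set S : Set (ℝ × ℝ) := closedBall c₀ L with hSdef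
  have hS : IsCompact S := isCompact_closedBall _ _
  -- 1. a box at each point, unit sub-boxes `W y` with compact closures `C y`, finite subcover
  choose eOf heOf hmem using F.exists_mem_source
  set W : M → Set M := fun y ↦ subbox (eOf y) (eOf y y) 1 with hWdef
  set C : M → Set M := fun y ↦ (eOf y).symm '' closedBall (eOf y y) 1 with hCdef
  have hCcpt : ∀ y, IsCompact (C y) := fun y ↦
    (isCompact_closedBall _ _).image (F.continuous_symm_of_mem (heOf y))
  have hCsrc : ∀ y, C y ⊆ (eOf y).source := fun y ↦ by
    rintro _ ⟨p, -, rfl⟩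
    exact (eOf y).map_target (by rw [F.target_eq _ (heOf y)]; exact mem_univ _)
  have hWC : ∀ y, W y ⊆ C y := fun y ↦ image_mono ball_subset_closedBall
  have hK : IsCompact (f '' S) := hS.image_of_continuousOn hf
  obtain ⟨t, -, htcov⟩ := hK.elim_nhds_subcover W fun y _ ↦
    (F.isOpen_subbox (heOf y)).mem_nhds (F.mem_subbox_self (heOf y) (hmem y) one_pos)
  -- 2. open sets of the plane cutting `S` along `f ⁻¹ (W y)`; a Lebesgue number
  have hU : ∀ y, ∃ U : Set (ℝ × ℝ), IsOpen U ∧ f ⁻¹' W y ∩ S = U ∩ S := fun y ↦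
    (continuousOn_iff'.1 hf) _ (F.isOpen_subbox (heOf y))
  choose U hUo hUeq using hU
  obtain ⟨δ₁, hδ₁, hLeb⟩ := lebesgue_number_lemma_of_metric (ι := ↥t) hS (c := fun y ↦ U y)
    (fun y ↦ hUo y) (by
      intro x hx
      obtain ⟨y, hy, hxy⟩ := mem_iUnion₂.1 (htcov (mem_image_of_mem f hx))
      have hxU : x ∈ U y ∩ S := by rw [← hUeq]; exact ⟨hxy, hx⟩
      exact mem_iUnion.2 ⟨⟨y, hy⟩, hxU.1⟩)
  -- 3. pairwise thickening radii in the box, and their minimum `ρ`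
  have hρ' : ∀ y y' : ↥t, ∃ ρ > (0 : ℝ), ∀ p ∈ (eOf y) '' (C y ∩ C y'),
      ball p ρ ⊆ (eOf y).symm ⁻¹' (eOf y').source := by
    intro y y'
    have hcpt : IsCompact ((eOf y) '' (C y ∩ C y')) :=
      ((hCcpt y).inter_right (hCcpt y').isClosed).image_of_continuousOn
        ((eOf (y : M)).continuousOn.mono (inter_subset_left.trans (hCsrc y)))
    have hopen : IsOpen ((eOf y).symm ⁻¹' (eOf y').source) :=
      (F.continuous_symm_of_mem (heOf y)).isOpen_preimage _ (eOf (y' : M)).open_source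
    have hsub : (eOf y) '' (C y ∩ C y') ⊆ (eOf y).symm ⁻¹' (eOf y').source := by
      rintro _ ⟨z, ⟨hz, hz'⟩, rfl⟩
      show (eOf y).symm (eOf y z) ∈ (eOf y').source
      rw [(eOf (y : M)).left_inv (hCsrc y hz)]
      exact hCsrc y' hz'
    obtain ⟨ρ, hρ, hthick⟩ := hcpt.exists_thickening_subset_open hopen hsub
    exact ⟨ρ, hρ, fun p hp ↦ (ball_subset_thickening hp ρ).trans hthick⟩
  choose ρf hρf hρfball using hρ'
  obtain ⟨ρ, hρ, hρle⟩ := exists_pos_forall_le (fun yy' : ↥t × ↥t ↦ ρf yy'.1 yy'.2)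
    fun _ ↦ hρf _ _
  -- 4. uniform continuity of the box coordinates of `f` on `S ∩ f ⁻¹ (C y)`
  have hη' : ∀ y : ↥t, ∃ η > (0 : ℝ), ∀ x ∈ S ∩ f ⁻¹' C y, ∀ x' ∈ S ∩ f ⁻¹' C y,
      dist x x' < η → dist (eOf y (f x)) (eOf y (f x')) < ρ / 4 := by
    intro y
    have hcl : IsClosed (S ∩ f ⁻¹' C y) :=
      hf.preimage_isClosed_of_isClosed isClosed_closedBall (hCcpt y).isClosed
    have hcpt : IsCompact (S ∩ f ⁻¹' C y) := hS.of_isClosed_subset hcl inter_subset_left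
    have hcont : ContinuousOn (fun x ↦ eOf y (f x)) (S ∩ f ⁻¹' C y) :=
      (eOf (y : M)).continuousOn.comp (hf.mono inter_subset_left) fun x hx ↦ hCsrc y hx.2
    obtain ⟨η, hη, h⟩ := Metric.uniformContinuousOn_iff.1
      (hcpt.uniformContinuousOn_of_continuous hcont) (ρ / 4) (by positivity)
    exact ⟨η, hη, fun x hx x' hx' hd ↦ h x hx x' hx' hd⟩
  choose ηf hηf hηfd using hη'
  obtain ⟨η, hη, hηle⟩ := exists_pos_forall_le ηf hηf
  -- 5. the mesh: `5 ℓ < min δ₁ η`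
  have hm : 0 < min δ₁ η := lt_min hδ₁ hη
  obtain ⟨n, hn'⟩ := exists_nat_gt (max (5 * L / min δ₁ η) N)
  have hn : 5 * L / min δ₁ η < n := lt_of_le_of_lt (le_max_left _ _) hn'
  have hNn : N ≤ n := by exact_mod_cast (lt_of_le_of_lt (le_max_right _ _) hn').le
  have hn₀' : (0 : ℝ) < n := lt_of_le_of_lt (by positivity) hn
  have hn₀ : 0 < n := Nat.cast_pos.1 hn₀'
  set g : Grid := grid c₀ hL hn₀ with hgdef
  have hgS : g.S = S := grid_S hL hn₀
  have hℓ : g.ℓ = L / n := rfl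
  have h5ℓ : 5 * g.ℓ < min δ₁ η := by
    rw [div_lt_iff₀ hm] at hn
    rw [hℓ, show 5 * (L / n) = 5 * L / n by ring, div_lt_iff₀ hn₀']
    linarith [mul_comm (n : ℝ) (min δ₁ η)]
  have h5δ : 5 * g.ℓ < δ₁ := lt_of_lt_of_le h5ℓ (min_le_left _ _)
  have h3η : 3 * g.ℓ < η := by linarith [lt_of_lt_of_le h5ℓ (min_le_right _ _), g.hℓ]
  -- 6. the boxes: a Lebesgue index at each centre
  have hcS : ∀ q, g.centre q ∈ S := fun q ↦ by rw [← hgS]; exact g.sq_subset_S q (g.centre_mem_sq q)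
  have hidx : ∀ q, ∃ y : ↥t, ball (g.centre q) δ₁ ⊆ U y := fun q ↦ hLeb _ (hcS q)
  choose yq hyq using hidx
  -- the star of `Q` is mapped into `W (yq Q)`
  have hstar : ∀ q q', g.Adj q q' → ∀ x ∈ g.sq q', x ∈ S ∧ f x ∈ W (yq q) := by
    intro q q' hadj x hx
    have hxS : x ∈ S := by rw [← hgS]; exact g.sq_subset_S q' hx
    have hxball : x ∈ ball (g.centre q) δ₁ := by
      have := g.sq_subset_closedBall_of_adj hadj hx
      rw [mem_closedBall] at this
      rw [mem_ball]
      linarith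
    have : x ∈ U (yq q) ∩ S := ⟨hyq q hxball, hxS⟩
    rw [← hUeq] at this
    exact ⟨hxS, this.1⟩
  refine ⟨n, hn₀, fun q ↦ eOf (yq q), ρ, hNn, hρ, fun q ↦ heOf _, ?_, ?_⟩
  · -- sub-boxes of radius `ρ` lie in the sources of the adjacent boxes
    intro q q' hadj
    have h1 := hstar q q (g.adj_refl q) _ (g.centre_mem_sq q)
    have h2 := hstar q' q hadj.symm _ (g.centre_mem_sq q)
    have hp : eOf (yq q) (f (g.centre q)) ∈ (eOf (yq q)) '' (C (yq q) ∩ C (yq q')) :=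
      mem_image_of_mem _ ⟨hWC _ h1.2, hWC _ h2.2⟩
    have hball := hρfball (yq q) (yq q') _ hp
    rintro _ ⟨p', hp', rfl⟩
    exact hball (ball_subset_ball (hρle (yq q, yq q')) hp')
  · -- `f` of an adjacent square lies in the sub-box of radius `ρ / 4`
    intro q q' hadj x hx
    obtain ⟨hxS, hxW⟩ := hstar q q' hadj x hx
    obtain ⟨hcS', hcW⟩ := hstar q q (g.adj_refl q) _ (g.centre_mem_sq q)
    have hd : dist x (g.centre q) < ηf (yq q) := by
      have := g.sq_subset_closedBall_of_adj hadj hx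
      rw [mem_closedBall] at this
      linarith [hηle (yq q)]
    have := hηfd (yq q) x ⟨hxS, hWC _ hxW⟩ (g.centre q) ⟨hcS', hWC _ hcW⟩ hd
    rw [F.mem_subbox_iff (heOf _)]
    exact ⟨F.subbox_subset_source (heOf _) hxW, mem_ball.2 this⟩

variable {F}

/-- **Relative cone position with a fine mesh.** [cite: CamachoLinsNeto1985, Ch. VI §3 Prop. 1] -/
theorem IsTransverselyOriented.exists_conePosition_rel_ge [NormedSpace ℝ B] {f : ℝ × ℝ → M}
    (ho : F.IsTransverselyOriented) (hL : 0 < L)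
    (hf : ContinuousOn f (closedBall c₀ L)) (T : Set (ℝ × ℝ)) (N : ℕ)
    (hbd : ∀ (n : ℕ) (hn : 0 < n), ∀ e ∈ F.atlas, ∀ q k, (grid c₀ hL hn).IsBoundaryEdge q k →
      (∀ s ∈ Icc 0 (2 * (grid c₀ hL hn).ℓ), f ((grid c₀ hL hn).edge q k s) ∈ e.source) →
      TameFunction.IsTameOn (fun s ↦ height e (f ((grid c₀ hL hn).edge q k s))) 0 (2 * (grid c₀ hL hn).ℓ))
    (hT : ∀ (n : ℕ) (hn : 0 < n), ∀ e ∈ F.atlas, ∀ q k, (grid c₀ hL hn).edge q k '' Icc 0 (2 * (grid c₀ hL hn).ℓ) ⊆ T →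
      (∀ s ∈ Icc 0 (2 * (grid c₀ hL hn).ℓ), f ((grid c₀ hL hn).edge q k s) ∈ e.source) →
      TameFunction.IsTameOn (fun s ↦ height e (f ((grid c₀ hL hn).edge q k s))) 0 (2 * (grid c₀ hL hn).ℓ)) :
    ∃ P : ConePosition F f c₀ hL, N ≤ P.n ∧ ∀ q k, P.gr.edge q k '' Icc 0 (2 * P.gr.ℓ) ⊆ T →
      ∀ s ∈ Icc 0 (2 * P.gr.ℓ), P.skel (P.gr.edge q k s) = f (P.gr.edge q k s) := by
  obtain ⟨n, hn, box, ρ, hNn, hρ, hbox, hsrc, hf4⟩ := F.exists_boxes_ge hL hf N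
  have hf' : ContinuousOn f (grid c₀ hL hn).S := by rwa [grid_S]
  set g := grid c₀ hL hn with hg
  have hsrc_edge : ∀ q k, ∀ s ∈ Icc 0 (2 * g.ℓ), f (g.edge q k s) ∈ (box q).source := fun q k s hs ↦
    F.subbox_subset_source (hbox q) (hf4 q q (g.adj_refl q) _ (g.edge_mem_sq q k hs))
  obtain ⟨g₁, h₀, h₁, h₂, h₃, h₄⟩ := ho.exists_tame_skeleton_rel g hbox hρ hf' hsrc hf4
    (fun q k hb ↦ hbd n hn (box q) (hbox q) q k hb (hsrc_edge q k))
    (fun E ↦ E.seg ⊆ T) (fun E hE ↦ hT n hn (box E.q) (hbox E.q) E.q E.k hE (hsrc_edge E.q E.k))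
  refine ⟨⟨n, hn, box, ρ, g₁, hρ, hbox, hsrc, hf4, h₁, h₂, h₃, h₄⟩, hNn, fun q k hqk s hs ↦ ?_⟩
  show g₁ (g.edge q k s) = f (g.edge q k s)
  rcases g.side_cases q k with hb | ⟨h, rfl⟩ | ⟨h, rfl⟩ | ⟨h, rfl⟩ | ⟨h, rfl⟩
  · exact h₁ q k hb s hs
  · exact h₀ (g.ownedBottom q h) hqk s hs
  · exact h₀ (g.ownedLeft q h) hqk s hs
  · rw [g.edge_one_eq_edge_up q h] at hqk ⊢
    exact h₀ (g.ownedBottom (g.up q h) (Nat.succ_pos _)) hqk s hs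
  · rw [g.edge_three_eq_edge_right q h] at hqk ⊢
    exact h₀ (g.ownedLeft (g.right q h) (Nat.succ_pos _)) hqk s hs

end Foliation

end Literature.Topology.FourManifolds
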